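import Summits.AtomisticToContinuum.Crystallization.Theorems.ChartedZeroExcessLayeredLatticeLiouvilleUP

/-!
# Zero-excess layered lattice Liouville — part UQ (lens-2 g56, node «SubWindowPieces»): the pieces beneath [SBᵇ] `SubWindowBudgetBPG` TYPED —
# (LD) `LinearExcessDecayZ`, (HC) `HarmonicComparisonZ`, (PT) `LinearisationDefectP` (this part) and (RC) `EquilChartStrainP` + the SB-glue (part UR).

Continuation of part UP (critic row 879: «NEXT NODE := part UQ = TYPE (LD)/(HC)/(PT) + the SB-glue»).  FINDINGS (mechanism level; they FORCE the shape of the pieces).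
(u5) FLOORS — the fixed-chart linear tower does NOT close.  The g55 mechanism for [SBᵇ] (linearise ONCE about the window chart `H`, Campanato iteration modulo
  LINEAR modes) has, at every scale `j` of the top-down recursion at a fixed centre `x`, excess sources proportional to the FULL local energy `m_j² ≈ A_B·η`
  and not to the excess `e_j`: the quadratic defect of the mode part (`δ₀²·m_j²`), the `εf·√bondEnergy(u)` term of (I4) (`εf²·m_j²`), the exact second-order
  inner force of a strained layered chart (`m_j⁴`).  Hence `e_{j+1} ≤ (Ct² + Cε²t⁻³)·e_j + Cε²t⁻³·m_j² + τ_j`: the excess does not decay below `ε²m_j²`, the mode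
  drifts by `≈ ε·m_j` PER SCALE, and over the `J ≈ log_{1/t}(8R/ρ₀)` scales down to `ρ₀` the drift is `≈ J·ε·√η` — unbounded in `R`, while [SBᵇ]'s quantifier
  order (`∃ ϑ₁ ω₁ … ∀ K₀ ∃ η₁ R₁ ∀ R ≥ R₁`) fixes `ε = ε(ϑ₁, ω₁, εf)` BEFORE `R`.  (DE-10 of the lineage.)
(u6) RE-CHARTING repairs it (Schoen–Uhlenbeck gauge re-centering; [giaquinta1984 Ch. III, proof of Thm 2.2: (2.12)+(2.13)] with the affine map replaced by an
  EXACT re-equilibrated strained equilibrium chart).  At scale `j` the chart `H_j` (an equilibrium chart, certified), `Ψ_j := Φ_{0→j} ∘ Ψ` (`Φ` the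
  index-preserving site correspondence `H → H_j`), `u_j := p − Ψ_j p`; the best mode of `u_j` on `B_{j+1}` is ABSORBED into `H_{j+1}` (piece (RC)).  Then every
  source is ∝ the NONLINEAR excess `ê_j := bondEnergy_{B_j}(u_j)/nK(B_j)` (`u_j` has the `B_j`-best mode removed, so its full density IS `ê_j`; `m_j² ≲ t⁻³ê_j`;
  `E(u_j; B_{2r_j}) ≲ t⁻⁶ ê_{j−1}·nK(B_j)` by mode rigidity (LD)(ii)); the recursion is
  `ê_{j+1} ≤ (Ct² + C(δ_*² + εf²)t⁻⁶/κ₁²)·(ê_j + ê_{j−1}) + Ct⁻⁶ê_j² + C·A·η·AT²·t⁻⁹/(κ₁²·r_j²)` (`δ_* = Cϱϑ₁ + CϱΣm` the near-bond gradient bound; last term =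
  (I4)'s dyadic tail at `(t, τ) = (r_j, 2r_j)`, `Θ_j ≈ Ct⁻³Aη` from the budgets at COARSER scales at the SAME centre), so `Σ_j √ê_j ≤ C√(Aη)·(1 + C/ρ₀)`, the
  total drift `Σ_j m_j = O(√η)` uniformly in `R`, and `bondEnergy_{B_j}(p − Ψp) ≤ 2ê_j·nK + 2C(Σm)²·nK ≤ A_B·η·nK(B_j)`.
(u7) CONSEQUENCES FOR THE TYPING.  (a) MODES are `ϱ`-truncated-harmonic `IsAffine` fields of LINEAR INDEX GROWTH (`IsIdxLipschitz`; NOT `BoundedGradient`, which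
  bounds a field across ALL layers and so kills the normal-strain/flux modes — DE-11), and (LD) carries a MODE-RIGIDITY clause (sup of increments² ≤ C·density on
  every large ball), without which neither `m_j² ≲ t⁻³ê_j` nor the drift summation is available ((D₁)'s `IsAffine` Taylor class has FREE per-layer constants — DE-8).
  (b) A fourth piece (RC) `EquilChartStrainP` is forced: linear modes are tangent, with error `(C_R m² + ε m)` per index step (`ε m` = truncated-linear vs
  full-nonlinear mismatch, `∀ ε ∃ ϱ₂` — DE-13), to re-equilibrated strained EQUILIBRIUM charts whose certificate `(c, C₁, κ)`, energy-nearness and chart tolerances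
  move ADDITIVELY in `m` (so `J` steps with `Σm = O(√η)` stay certified); cleanliness of the strained chart needs a MARGIN, supplied inside (RC) by energy-nearness
  `ν ≤ ν'` (a chart of the clean class sitting AT the threshold breaks under every compressive strain — DE-12).  (c) hU/hN are consumed ONCE (window chart); the
  iterates' certificates come from (RC).  (d) (I4) is consumed at the ENLARGED chart class `(Λ', s')` ⊇ the iterates AND with SLACK tear-free thresholds
  (`4 ↦ 9` forward, `3 ↦ 8` reverse: the re-charted registration `Ψ_j = Φ_{0→j} ∘ Ψ` distorts bond lengths by the global strain `O(√η)`, so `Ψ`'s `4 ↦ 8` both ways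
  becomes `4 ↦ 8(1 + C√η)`) — the variant (I4ˢ) `TailFluxBSP` of part UR, same mechanism and grade as (I4); `tailFluxBP_of_tailFluxBSP` (PROVED, UR) recovers the
  docket's (I4) instance, so ONE literal `TailFluxBSP 1 3 (1/16) (1/25)` serves both glues.  (e) (T) `TailDominationCert` (part R, cert of record) is the
  antecedent of (LD)/(HC) exactly as it is of (D₁) `InteriorDecayCert`.
PIECE TABLE (all chart-free unless said; [SBᵇ] ⟸ SB-glue(all of them), part UR):
  (T)  `TailDominationCert`      part R · TRUE-type · ATTACKABLE·M (cert of record, shared with the (H) column).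
  (LD) `LinearExcessDecayZ`      NEW · LINEAR · TRUE-type · ATTACKABLE·M–L · WEAKER than [SBᵇ] (linear, one operator, no `S`) · ABOVE (D₁): `interiorDecayCert_of_
       linearExcessDecayZ` PROVED.  Print: [giaquinta1984 Ch. III Thm 2.1 (2.8), (2.12)] (Campanato `(ρ/R)^{n+2}` excess decay, constant coefficients);
       [corpus:arxiv-1306.5334 Lemma 6 (lattice Green's function `|D_ρ G(ℓ)| ≤ C(1+|ℓ|)^{−d−j+2}`), Lemma 7] (EOS16, Bravais); laminates [Li–Nirenberg CPAM 2003].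
  (HC) `HarmonicComparisonZ`     NEW · LINEAR · TRUE-type · ATTACKABLE·S–M.  Print: [giaquinta1984 Ch. III proof of Thm 2.2: Lax–Milgram Dirichlet solve (fn. 9) +
       energy identity (2.13)]; coercivity of the truncated form = `CoerciveZ` − (T).
  (PT) `LinearisationDefectP`    NEW · TRUE-type · PROVABLE·S (bookkeeping identity over `tailForce_layeredHom_eq_near_sub_near`, part TF; `pairForce` odd,
       `forceConst` even — `defectKernel_neg_neg` PROVED); its quadratic BOUND is (I1) `PairForceTaylorP` BY DEFINITION of `defectKernel` (PROVED, UP).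
  (RC) `EquilChartStrainP`       NEW · NONLINEAR·chart-level · TRUE-type · ATTACKABLE·M + INSTRUMENTABLE (cleanliness/energy margins of `ν'`-near charts) — part UR.
No item of this part re-types the leaf: [SBᵇ] stays verbatim (part UN); the pieces are consumed only through the typed glue of part UR.
-/

noncomputable section

open scoped BigOperators InnerProductSpace RealInnerProductSpace
open MeasureTheory Set Metric Filter Topology
open Summit.AtomisticToContinuum.Crystallization.Theorems.ChartedPlanarOrderRigidityDoor (E3 IsNash atomsIn)
open Summit.AtomisticToContinuum.Crystallization.Theorems.ChartedPlanarOrderDensityDichotomy (μS IsSep nK nK_nonneg)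
open Summit.AtomisticToContinuum.Crystallization.Theorems.ChartedPlanarOrderMesoCut (LayeredHom)
open Summit.AtomisticToContinuum.Crystallization.Theorems.ChartedPlanarOrderDoorLayered (Layered layeredHom_eq_layered)
open Summit.AtomisticToContinuum.Crystallization.Theorems.ChartedPlanarOrderProfileSlavingLJ (pairForce)
open Summit.AtomisticToContinuum.Crystallization.Theorems.ChartedPlanarOrderProfileSlavingLJBalance (pairForce_neg)

namespace Summit.AtomisticToContinuum.Crystallization.Theorems.ChartedZeroExcessLayeredLatticeLiouville

/-! ### UQ.1  (LD) Modal excess decay for certified laminates — the decay piece with HARMONIC MODES and MODE RIGIDITY -/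

/-- linear index growth: `M` is `m`-Lipschitz on the index lattice `ℤ² × ℤ` (sup metric); `m` is THE SIZE of a mode.  (Not `BoundedGradient`: that bounds `M` across all
layers and excludes the normal-strain / flux modes, (u7a).) [this file, g56] -/
def IsIdxLipschitz (m : ℝ) (M : Cell 2 → ℤ → E3) : Prop :=
  ∀ X Y : Cell 2 × ℤ, ‖M Y.1 Y.2 - M X.1 X.2‖ ≤ m * dist X Y

/-- **a `ϱ`-TRUNCATED MODE of the layered crystal `(a, b, w)`**: an `IsAffine` field (ONE in-plane gradient, per-layer vectors) of linear index growth that is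
`ϱ`-truncated-harmonic EVERYWHERE — the linear tangent space of the family of strained, re-equilibrated equilibrium charts (in-plane strain 6 + flux 3 +
translation 3 parameters once the 1D chain Liouville theorem holds; that count is NOT assumed anywhere). Closed under the constants (`isTruncMode_const`). [this file, g56] -/
def IsTruncMode (ϱ : ℝ) (a b : E3) (w : ℤ → E3) (M : Cell 2 → ℤ → E3) : Prop :=
  IsAffine M ∧ (∃ m : ℝ, IsIdxLipschitz m M) ∧ IsTruncHarmonicZ ϱ a b w M Set.univ

/-- sanity: constant fields are modes. [this file, g56] -/
theorem isTruncMode_const (ϱ : ℝ) (a b : E3) (w : ℤ → E3) (v : E3) : IsTruncMode ϱ a b w (fun _ _ => v) :=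
  ⟨⟨fun _ => 0, fun _ => v, fun γ α => by simp⟩, ⟨0, fun X Y => by simp⟩, isTruncHarmonicZ_const ϱ a b w _ v⟩

/-- **MODAL DECAY PACKAGE** `ModalDecayAt C ϱ t n₁ a b w`: part S's `DecayAt` with the Taylor class `IsAffine` STRENGTHENED to `IsTruncMode` — the subtracted field is
itself harmonic, so the remainder `φ − M` is again truncated-harmonic and the step ITERATES (Campanato). [this file, g56] -/
def ModalDecayAt (C ϱ t n₁ : ℝ) (a b : E3) (w : ℤ → E3) : Prop :=
  ∀ (φ : Cell 2 → ℤ → E3) (x₀ : Cell 2 × ℤ) (n : ℝ), n₁ ≤ n →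
    IsTruncHarmonicZ ϱ a b w φ (idxBall x₀ n) →
      ∃ M : Cell 2 → ℤ → E3, IsTruncMode ϱ a b w M ∧
        idxEnergy (φ - M) (idxBall x₀ (t * n)) * ((idxBall x₀ n).ncard : ℝ) ≤
          C * t ^ 2 * idxEnergy φ (idxBall x₀ n) * ((idxBall x₀ (t * n)).ncard : ℝ)

/-- **MODE RIGIDITY** `ModeRigidAt C ϱ n₁ a b w`: the increments of a mode are controlled, GLOBALLY, by its energy density on ANY index ball of radius `≥ n₁`
(`‖M Y − M X‖²·#B ≤ C·dist(X,Y)²·idxEnergy_B M`) — modes form a rigid finite-dimensional-like family (in-plane increments are the constant gradient; cross-layer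
increments of a Lipschitz chain solution are comparable at all layers under `CoerciveZ`).  Gives `m² ≲ density` and the small-ball/large-ball comparison used in
the drift summation (u6). [this file, g56] -/
def ModeRigidAt (C ϱ n₁ : ℝ) (a b : E3) (w : ℤ → E3) : Prop :=
  ∀ M : Cell 2 → ℤ → E3, IsTruncMode ϱ a b w M → ∀ (x₀ : Cell 2 × ℤ) (n : ℝ), n₁ ≤ n →
    ∀ X Y : Cell 2 × ℤ, ‖M Y.1 Y.2 - M X.1 X.2‖ ^ 2 * ((idxBall x₀ n).ncard : ℝ) ≤ C * dist X Y ^ 2 * idxEnergy M (idxBall x₀ n)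

/-- ★ **(LD) `LinearExcessDecayZ` — CAMPANATO EXCESS DECAY MODULO HARMONIC MODES, UNIFORM OVER CERTIFIED LAMINATES** (chart-free, LINEAR): given the tail
certificate (T), for all certificate constants `(κ₀, c₀, C₁)` there are `C ≥ 1`, a range `ϱ₁` and, per `(ϱ, t)`, a scale `n₁` such that EVERY `c₀`-co-Lipschitz,
`C₁`-tame, `κ₀`-coercive layered crystal has the modal decay package AND mode rigidity.  Consumes EXACTLY hU's certificate (`IsLayeredCrystal c₀`,
`IsTameIndexing C₁`, `CoerciveZ (layeredKernel …) κ₀`) — no new cert.  NEW · LINEAR · TRUE-type · ATTACKABLE·M–L · strictly ABOVE (D₁) (`interiorDecayCert_of_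
linearExcessDecayZ`) · WEAKER than [SBᵇ] (no configuration `S`, no registration, one fixed operator).  Nearest print: [giaquinta1984 Ch. III Thm 2.1, estimates
(2.8)/(2.12)] (decay `(ρ/R)^{n+2}` of `∫|∇v − (∇v)_ρ|²` for constant-coefficient systems — here «constant» = homogeneous laminate, «(∇v)_ρ» = best mode);
[corpus:arxiv-1306.5334 Lemma 6, Lemma 7] (EOS16: lattice Green's function and `Du` decay for BRAVAIS lattices under lattice stability); laminates with
coefficients depending on one variable: [Li–Nirenberg, CPAM 56 (2003)] (cite-level).  Why it might fail: (i) for an APERIODIC stacking word the operator is a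
laminate, not a Bravais lattice: uniformity of `C` over all certified words is a compactness/Caccioppoli argument on the layer chain (the 1D chain Liouville for
Lipschitz solutions is inside clause (ii)); (ii) the Taylor class must be closed under the iteration — true modes only, hence the harmonicity requirement in
`IsTruncMode`, and the best `IsAffine` fit of (D₁) need not be harmonic (inner relaxation couples gradient and layer vectors).
Sources: [giaquinta1984 Ch. III §2], [corpus:arxiv-1306.5334 §§3.2–3.3], [EMing2006], parts S ((D₁) `DecayAt`, `InteriorDecayCert`), E, B. [this file, g56] -/
def LinearExcessDecayZ : Prop :=
  TailDominationCert → ∀ κ₀ : ℝ, 0 < κ₀ → ∀ c₀ : ℝ, 0 < c₀ → ∀ C₁ : ℝ, 0 < C₁ →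
    ∃ C : ℝ, 1 ≤ C ∧ ∃ ϱ₁ : ℝ, 1 ≤ ϱ₁ ∧ ∀ ϱ : ℝ, ϱ₁ ≤ ϱ → ∀ t : ℝ, 0 < t → t ≤ 1 / 2 → ∃ n₁ : ℝ, 0 < n₁ ∧
      ∀ (a b : E3) (w : ℤ → E3), IsLayeredCrystal c₀ a b w → IsTameIndexing C₁ a b w → CoerciveZ (layeredKernel a b w) κ₀ →
        ModalDecayAt C ϱ t n₁ a b w ∧ ModeRigidAt C ϱ n₁ a b w

/-- seam: the modal package implies part S's decay package (a mode is `IsAffine`). [this file, g56] -/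
theorem ModalDecayAt.decayAt {C ϱ t n₁ : ℝ} {a b : E3} {w : ℤ → E3} (h : ModalDecayAt C ϱ t n₁ a b w) : DecayAt C ϱ t n₁ a b w := by
  intro φ x₀ n hn hφ
  obtain ⟨M, hM, hle⟩ := h φ x₀ n hn hφ
  exact ⟨M, hM.1, hle⟩

/-- ★ seam (LD) ⇒ (D₁): `LinearExcessDecayZ` sits ABOVE part S's `InteriorDecayCert` (same quantifier skeleton, stronger Taylor class). [this file, g56] -/
theorem interiorDecayCert_of_linearExcessDecayZ (h : LinearExcessDecayZ) : InteriorDecayCert := by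
  intro hT κ₀ hκ₀ c₀ hc₀ C₁ hC₁
  obtain ⟨C, hC, ϱ₁, hϱ₁, hϱ⟩ := h hT κ₀ hκ₀ c₀ hc₀ C₁ hC₁
  refine ⟨C, hC, ϱ₁, hϱ₁, fun ϱ hle t ht ht' => ?_⟩
  obtain ⟨n₁, hn₁, hn⟩ := hϱ ϱ hle t ht ht'
  exact ⟨n₁, hn₁, fun a b w h₁ h₂ h₃ => (hn a b w h₁ h₂ h₃).1.decayAt⟩

/-! ### UQ.2  (HC) Harmonic comparison (Dirichlet solve + energy identity) for the truncated linearised operator -/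

/-- the `ϱ`-TRUNCATED LINEARISED RESIDUAL of `φ` at the index site `X` — the `tsum` whose vanishing on `P` IS `IsTruncHarmonicZ ϱ a b w φ P`
(`truncResidual_eq_zero_of_isTruncHarmonicZ`); finitely supported for co-Lipschitz crystals. [this file, g56] -/
def truncResidual (ϱ : ℝ) (a b : E3) (w : ℤ → E3) (φ : Cell 2 → ℤ → E3) (X : Cell 2 × ℤ) : E3 :=
  ∑' Y : Cell 2 × ℤ, (if ϱ < ‖lsite a b w Y.1 Y.2 - lsite a b w X.1 X.2‖ then (0 : E3)
    else layeredKernel a b w (Y.1 - X.1) X.2 Y.2 (φ Y.1 Y.2 - φ X.1 X.2))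

/-- dictionary: truncated harmonicity on `P` kills the residual on `P`. [this file, g56] -/
theorem truncResidual_eq_zero_of_isTruncHarmonicZ {ϱ : ℝ} {a b : E3} {w : ℤ → E3} {φ : Cell 2 → ℤ → E3} {P : Set (Cell 2 × ℤ)}
    (h : IsTruncHarmonicZ ϱ a b w φ P) {X : Cell 2 × ℤ} (hX : X ∈ P) : truncResidual ϱ a b w φ X = 0 := by
  unfold truncResidual
  exact (h X hX).tsum_eq

/-- ★ **(HC) `HarmonicComparisonZ` — DIRICHLET SOLVABILITY + COMPARISON ENERGY IDENTITY for the truncated operator of a certified laminate** (chart-free, LINEAR):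
given (T), for all `(κ₀, c₀, C₁)` there are `κ₁ > 0` and a range `ϱ₁` such that for every certified crystal, every FINITE index set `P` and every field `φ`
there is a comparison field `V` with `V = φ` off `P`, `V` `ϱ`-truncated-harmonic ON `P`, and
`κ₁ · idxEnergy_{N₁(P)}(φ − V) ≤ |Σ_{X ∈ P} ⟪truncResidual φ X, φ X − V X⟫|` (coercivity of the truncated form on fields supported in `P` — `CoerciveZ` minus
the (T)-tail — tested against `φ − V`; the absolute value makes the sign convention immaterial).  The glue feeds the right-hand side with (PT): residual =
−tail force − Σ defect.  NEW · LINEAR · TRUE-type · ATTACKABLE·S–M.  Nearest print: [giaquinta1984 Ch. III, proof of Thm 2.2: Dirichlet problem by Lax–Milgram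
(footnote 9) and the energy identity (2.13) `∫|∇w|² ≤ c∫|f − f_R|²`, `w = u − v`].  Why it might fail: only bookkeeping — the truncated bilinear form on the
finite-dimensional space of fields supported in `P` must be shown coercive from `CoerciveZ` (stated with `HasSum` over ordered pairs) and the (T) tail bound
`≤ ε·nnFormZ`, with `ε(ϱ₁) < κ₀`; existence is then finite-dimensional linear algebra.  Sources: [giaquinta1984 Ch. III §2], parts B (`CoerciveZ`), R ((T)),
S (`IsTruncHarmonicZ`, `idxEnergy`). [this file, g56] -/
def HarmonicComparisonZ : Prop :=
  TailDominationCert → ∀ κ₀ : ℝ, 0 < κ₀ → ∀ c₀ : ℝ, 0 < c₀ → ∀ C₁ : ℝ, 0 < C₁ →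
    ∃ κ₁ : ℝ, 0 < κ₁ ∧ ∃ ϱ₁ : ℝ, 1 ≤ ϱ₁ ∧ ∀ ϱ : ℝ, ϱ₁ ≤ ϱ →
      ∀ (a b : E3) (w : ℤ → E3), IsLayeredCrystal c₀ a b w → IsTameIndexing C₁ a b w → CoerciveZ (layeredKernel a b w) κ₀ →
        ∀ P : Set (Cell 2 × ℤ), P.Finite → ∀ φ : Cell 2 → ℤ → E3,
          ∃ V : Cell 2 → ℤ → E3, (∀ X : Cell 2 × ℤ, X ∉ P → V X.1 X.2 = φ X.1 X.2) ∧ IsTruncHarmonicZ ϱ a b w V P ∧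
            κ₁ * idxEnergy (φ - V) {X | ∃ Y ∈ P, dist X Y ≤ 1} ≤
              |∑ᶠ X ∈ P, ⟪truncResidual ϱ a b w φ X, φ X.1 X.2 - V X.1 X.2⟫_ℝ|

/-! ### UQ.3  (PT) The linearisation defect: truncated residual of the pulled-back displacement = −(tail force) − Σ (second-order pair defects) -/

/-- the SECOND-ORDER DEFECT of the pair force at a bond `z` displaced by `h`: `pairForce (z + h) − pairForce z + forceConst z h` (`forceConst = −D pairForce`,
part UP `forceConst_apply_eq_neg_pairJac`).  Its uniform quadratic bound off the core IS (I1) `PairForceTaylorP` (`norm_defectKernel_le`). [this file, g56] -/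
def defectKernel (z h : E3) : E3 :=
  pairForce (z + h) - pairForce z + forceConst z h

/-- antisymmetry under bond reversal (`pairForce` odd, `forceConst` even): the defects pair ANTISYMMETRICALLY, so against a test field they are summed by parts
(`Σ_X ⟪Σ_Y G X Y, ψ X⟫ = ½ Σ_{X,Y} ⟪G X Y, ψ X − ψ Y⟫`). [this file, g56] -/
theorem defectKernel_neg_neg (z h : E3) : defectKernel (-z) (-h) = -defectKernel z h := by
  unfold defectKernel
  rw [show -z + -h = -(z + h) from by abel, pairForce_neg (z + h), pairForce_neg z, forceConst_neg z, map_neg]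
  abel

/-- (I1) restated for the defect kernel (definitional). [this file, g56] -/
theorem norm_defectKernel_le (h : PairForceTaylorP) :
    ∃ C : ℝ, 0 < C ∧ ∀ z v : E3, 27 / 32 ≤ ‖z‖ → ‖v‖ ≤ 1 / 4 → ‖defectKernel z v‖ ≤ C * ‖v‖ ^ 2 :=
  h

/-- the PULLED-BACK DISPLACEMENT of a registration `Ψ : S → Layered b₁ b₂ w` (bijective): at the index site `(γ, m)` the vector `Ψ⁻¹(q) − q`, `q = lsite b₁ b₂ w γ m`
— the index-form field on which (LD)/(HC) act (`u p = p − Ψ p` read through `Ψ`). [this file, g56] -/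
def pullDisp (S : Set E3) (Ψ : E3 → E3) (b₁ b₂ : E3) (w : ℤ → E3) : Cell 2 → ℤ → E3 :=
  fun γ m => Function.invFunOn Ψ S (lsite b₁ b₂ w γ m) - lsite b₁ b₂ w γ m

/-- ★ **(PT) `LinearisationDefectP` — THE LINEARISATION IDENTITY** (bookkeeping over part TF): for a `δ`-separated NASH configuration `S`, a co-Lipschitz-indexed
layered set `H = Layered b₁ b₂ w` that is `27/32`-separated and NASH, a bijection `Ψ : S → H` and `ϱ > 0`, at every index site `X` (atom `x = Ψ⁻¹(lsite X)`):
`truncResidual ϱ (pullDisp) X + tailForce ϱ S H Ψ x = − Σ_{Y ≠ X, ‖lsite Y − lsite X‖ ≤ ϱ} defectKernel (lsite X − lsite Y) (φ X − φ Y)`, `φ = pullDisp S Ψ b₁ b₂ w`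
— from `tailForce_layeredHom_eq_near_sub_near` (tail = near model sum − near `S`-sum, both force balances), re-indexing the near sums through `Ψ` and `lsite`
(`injective_lsite_of_isLayeredCrystal`), `pairForce (z + h) = pairForce z − forceConst z h + defectKernel z h`, `forceConst` even.  With (I1) (`‖defectKernel z h‖ ≤
C_T‖h‖²` for `‖z‖ ≥ 27/32`, `‖h‖ ≤ 1/4`) and `defectKernel_neg_neg` the glue bounds the defect pairing by `C_T·δ_*·√E(u)·√E(ψ)`.  NEW · TRUE-type · PROVABLE·S.
Why it might fail: only bookkeeping (membership `Ψ⁻¹(lsite X) ∈ S` via `BijOn`, finiteness of the near index sums from co-Lipschitz + separation, the `tsum`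
↔ finite-sum conversions).  Sources: part TF (`tailForce_layeredHom_eq_near_sub_near`, `hasSum_pairForce_of_isNash`), part UP ((I1)), [EMing2006] (Cauchy–Born
linearisation), [corpus:arxiv-1306.5334 §8.3 «decay of residual forces»]. [this file, g56] -/
def LinearisationDefectP : Prop :=
  ∀ δ : ℝ, 0 < δ → ∀ S : Set E3, IsSep δ S → IsNash (μS S) →
    ∀ c : ℝ, 0 < c → ∀ (b₁ b₂ : E3) (w : ℤ → E3), IsLayeredCrystal c b₁ b₂ w →
      IsSep (27 / 32) (Layered b₁ b₂ w) → IsNash (μS (Layered b₁ b₂ w)) →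
        ∀ Ψ : E3 → E3, Set.BijOn Ψ S (Layered b₁ b₂ w) → ∀ ϱ : ℝ, 0 < ϱ → ∀ X : Cell 2 × ℤ,
          truncResidual ϱ b₁ b₂ w (pullDisp S Ψ b₁ b₂ w) X +
              tailForce ϱ S (Layered b₁ b₂ w) Ψ (Function.invFunOn Ψ S (lsite b₁ b₂ w X.1 X.2)) =
            -∑' Y : Cell 2 × ℤ, (if Y ≠ X ∧ ‖lsite b₁ b₂ w Y.1 Y.2 - lsite b₁ b₂ w X.1 X.2‖ ≤ ϱ then
                defectKernel (lsite b₁ b₂ w X.1 X.2 - lsite b₁ b₂ w Y.1 Y.2)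
                  (pullDisp S Ψ b₁ b₂ w X.1 X.2 - pullDisp S Ψ b₁ b₂ w Y.1 Y.2)
              else 0)

/-- sanity (the identity's trivial instance is NOT vacuous bookkeeping: at `φ = 0` both near sums agree termwise): the defect of an undisplaced bond vanishes. -/
theorem defectKernel_zero_right (z : E3) : defectKernel z 0 = 0 := by
  simp [defectKernel]

end Summit.AtomisticToContinuum.Crystallization.Theorems.ChartedZeroExcessLayeredLatticeLiouville

end
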